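import Summits.AtomisticToContinuum.FouriersLaw.Theses.OddSectorIrreversibility
import Summits.AtomisticToContinuum.FouriersLaw.Theorems.BondHeatUncertaintySubdiffusiveBondHeatKernelGibbsF
import Mathlib.Analysis.SpecialFunctions.ImproperIntegrals
import Mathlib.MeasureTheory.Integral.IntegralEqImproper

/-!
# `OddDensityIsCorrector`, part 6: the resolvent `R_λ = ∫₀^∞ e^{-λt} P_t dt` of the equilibrium kernels

Helper file for support item `stmt-AtomisticToContinuum-9146`
(`OddSectorIrreversibility.OddDensityIsCorrector`).

Equilibrium transition kernels `P_t = transitionKernel N T T t` of the pinned anharmonic chain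
(`ω₂ > 0`, `lam ≥ 0`, `β, γ > 0`, `N ≥ 1`, `T > 0`), acting on NICE observables — continuous `f`
with `|f| ≤ C e^{ϑH}`, `0 < ϑ < 1/T`:

* `pinnedChain_harris_bound` — CEHR (2.5) at equilibrium, scaled: `|P_t f(z) - μ_T(f)| ≤ K C e^{ϑH(z)} e^{-ct}`
  (`pinnedChain_exp_convergence_gibbs`), and the `t`-uniform bound
  `|P_t f(z)| ≤ (|μ_T(f)| + K C) e^{ϑH(z)}` (`pinnedChain_abs_act_le`);
* `pinnedChain_stronglyMeasurable_act_uncurry` — `(t, z) ↦ P_{t⁺} f(z)` is jointly measurable;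
* the resolvent `R_λ f(z) = ∫_{(0,∞)} e^{-λt} P_t f(z) dt` (`λ > 0`, written out): the integrand is
  integrable (`pinnedChain_integrableOn_resolvent`), `|R_λ f(z)| ≤ (|μ_T f| + KC) e^{ϑH(z)}/λ`
  (`pinnedChain_abs_resolvent_le`), `z ↦ R_λ f(z)` is measurable, `R_λ` is linear;
* `pinnedChain_resolvent_generator` — **Dynkin's identity in resolvent form**: for a test function `F`,
  `R_λ(L F)(z) = λ R_λ F(z) - F(z)`, hence `R_λ(λF - LF) = F` (`pinnedChain_resolvent_sub_generator`):
  `t ↦ P_tF(z)` is `C¹` on `(0,∞)` with derivative `P_t(LF)(z)` (Dynkin + FTC), and one integrates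
  `d/dt (e^{-λt} P_tF(z))` over `(0, ∞)`.

Nothing here closes an item.
-/

noncomputable section

open MeasureTheory ProbabilityTheory Filter Topology Set Function
open scoped ContDiff NNReal ENNReal
open Literature.MathematicalPhysics.KineticTheory.HeatConduction
open Summit.AtomisticToContinuum.FouriersLaw.Theorems.SubdiffusiveBondHeat

namespace Summit.AtomisticToContinuum.FouriersLaw.Theorems.OddSectorIrreversibility

variable {N : ℕ}

section Pinned

variable {ω₂ lam β γ : ℝ} (hω : 0 < ω₂) (hl : 0 ≤ lam) (hβ : 0 < β) (hγ : 0 < γ) (hN : 0 < N)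
  {T : ℝ} (hT : 0 < T)
include hω hl hβ hγ hN hT

/-! ### Harris bound, scaled -/

/-- **CEHR (2.5) at equilibrium for `f` dominated by `C e^{ϑH}`**: there are `K, c > 0` (depending on
`ϑ ∈ (0, 1/T)` only) with `|P_t f(z) - μ_T(f)| ≤ K C e^{ϑH(z)} e^{-ct}` for all `z`, `t ≥ 0`, `C ≥ 0` and
continuous `f` with `|f| ≤ C e^{ϑH}`. [cite: CuneoEckmannHairerReyBellet2018, Thm 2.13 eq. (2.5)] -/
theorem pinnedChain_harris_bound {ϑ : ℝ} (hϑ0 : 0 < ϑ) (hϑ1 : ϑ < 1 / T) :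
    ∃ K c : ℝ, 0 < K ∧ 0 < c ∧ ∀ (z : PhaseSpace N) (t : ℝ≥0) (f : PhaseSpace N → ℝ), Continuous f →
      ∀ C : ℝ, 0 ≤ C → (∀ y, |f y| ≤ C * Real.exp (ϑ * (pinnedChain ω₂ lam β γ).hamiltonian N y)) →
      |(∫ y, f y ∂((pinnedChain ω₂ lam β γ).transitionKernel N T T t z)) -
          ∫ y, f y ∂((pinnedChain ω₂ lam β γ).gibbsMeasure N T)| ≤
        K * C * Real.exp (ϑ * (pinnedChain ω₂ lam β γ).hamiltonian N z) * Real.exp (-c * t) := by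
  obtain ⟨K, c, hK, hc, hb⟩ := pinnedChain_exp_convergence_gibbs hω hl hβ hγ hN hT hϑ0 hϑ1
  refine ⟨K, c, hK, hc, fun z t f hf C hC hfb => ?_⟩
  rcases hC.eq_or_lt with hC0 | hCpos
  · -- `C = 0`: `f = 0`
    have hf0 : f = fun _ => 0 := funext fun y => by
      have := hfb y; rw [← hC0, zero_mul] at this; exact abs_nonpos_iff.1 this
    subst hf0
    simp [← hC0]
  · have h := hb z t (fun y => f y / C) (hf.div_const C) (fun y => by
      rw [abs_div, abs_of_pos hCpos, div_le_iff₀ hCpos]; linarith [hfb y])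
    rw [integral_div, integral_div, ← sub_div, abs_div, abs_of_pos hCpos, div_le_iff₀ hCpos] at h
    linarith [h]

omit hγ hN hT in
/-- `1 ≤ e^{ϑH}` for the pinned chain (`H ≥ 0`, `ϑ ≥ 0`). [folklore] -/
theorem pinnedChain_one_le_exp_mul_hamiltonian {ϑ : ℝ} (hϑ : 0 ≤ ϑ) (z : PhaseSpace N) :
    1 ≤ Real.exp (ϑ * (pinnedChain ω₂ lam β γ).hamiltonian N z) :=
  Real.one_le_exp (mul_nonneg hϑ (pinnedChain_hamiltonian_nonneg hω.le hl hβ.le γ N z))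

omit hγ hN hT in
/-- **`t`-uniform bound**: with `K, c` from `pinnedChain_harris_bound`,
`|P_t f(z)| ≤ (|μ_T(f)| + K C) e^{ϑH(z)}` for nice `f`. [folklore] -/
theorem pinnedChain_abs_act_le {ϑ K c : ℝ} (hϑ0 : 0 < ϑ)
    (hb : ∀ (z : PhaseSpace N) (t : ℝ≥0) (f : PhaseSpace N → ℝ), Continuous f →
      ∀ C : ℝ, 0 ≤ C → (∀ y, |f y| ≤ C * Real.exp (ϑ * (pinnedChain ω₂ lam β γ).hamiltonian N y)) →
      |(∫ y, f y ∂((pinnedChain ω₂ lam β γ).transitionKernel N T T t z)) -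
          ∫ y, f y ∂((pinnedChain ω₂ lam β γ).gibbsMeasure N T)| ≤
        K * C * Real.exp (ϑ * (pinnedChain ω₂ lam β γ).hamiltonian N z) * Real.exp (-c * t))
    (hc : 0 < c) {f : PhaseSpace N → ℝ} (hf : Continuous f) {C : ℝ} (hC : 0 ≤ C)
    (hfb : ∀ y, |f y| ≤ C * Real.exp (ϑ * (pinnedChain ω₂ lam β γ).hamiltonian N y))
    (z : PhaseSpace N) (t : ℝ≥0) :
    |∫ y, f y ∂((pinnedChain ω₂ lam β γ).transitionKernel N T T t z)| ≤
      (|∫ y, f y ∂((pinnedChain ω₂ lam β γ).gibbsMeasure N T)| + K * C) *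
        Real.exp (ϑ * (pinnedChain ω₂ lam β γ).hamiltonian N z) := by
  have h := hb z t f hf C hC hfb
  have hE := pinnedChain_one_le_exp_mul_hamiltonian hω hl hβ (γ := γ) (N := N) hϑ0.le z
  have hct : Real.exp (-c * t) ≤ 1 := Real.exp_le_one_iff.2 (by
    have : (0 : ℝ) ≤ t := t.coe_nonneg; nlinarith)
  set E := Real.exp (ϑ * (pinnedChain ω₂ lam β γ).hamiltonian N z)
  set m := ∫ y, f y ∂((pinnedChain ω₂ lam β γ).gibbsMeasure N T)
  have hKC : 0 ≤ K * C * E := by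
    have : 0 ≤ K * C * E * Real.exp (-c * t) := (abs_nonneg _).trans h
    have hpos : 0 < Real.exp (-c * t) := Real.exp_pos _
    nlinarith
  have h1 : K * C * E * Real.exp (-c * t) ≤ K * C * E := by nlinarith
  calc |∫ y, f y ∂((pinnedChain ω₂ lam β γ).transitionKernel N T T t z)|
      ≤ |m| + K * C * E * Real.exp (-c * t) := by
        have := abs_sub_abs_le_abs_sub (∫ y, f y ∂((pinnedChain ω₂ lam β γ).transitionKernel N T T t z)) m
        linarith
    _ ≤ |m| * E + K * C * E := by nlinarith [abs_nonneg m]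
    _ = (|m| + K * C) * E := by ring

/-! ### Joint measurability of `(t, z) ↦ P_{t⁺} f(z)` -/

omit hβ hγ hN hT in
/-- `(t, z) ↦ P_{t⁺} f(z)` is jointly (strongly) measurable for measurable `f`. [folklore] -/
theorem pinnedChain_stronglyMeasurable_act_uncurry (hβ' : 0 ≤ β) (hγ' : 0 ≤ γ) (T_L T_R : ℝ)
    {f : PhaseSpace N → ℝ} (hf : Measurable f) :
    StronglyMeasurable fun q : ℝ × PhaseSpace N =>
      ∫ y, f y ∂((pinnedChain ω₂ lam β γ).transitionKernel N T_L T_R q.1.toNNReal q.2) := by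
  let Kq : Kernel (ℝ × PhaseSpace N) (PhaseSpace N) :=
    { toFun := fun q => (pinnedChain ω₂ lam β γ).transitionKernel N T_L T_R q.1.toNNReal q.2
      measurable' := by
        have h1 : Measurable fun q : ℝ × PhaseSpace N => (q.1.toNNReal, q.2) :=
          (measurable_real_toNNReal.comp measurable_fst).prodMk measurable_snd
        have h2 := (pinnedChain_measurable_transitionKernel hω hl hβ' hγ' N T_L T_R).comp h1
        exact h2 }
  haveI : IsMarkovKernel Kq :=
    ⟨fun q => (pinnedChain_isMarkovKernel_transitionKernel hω hl hβ' hγ' N T_L T_R q.1.toNNReal).isProbabilityMeasure q.2⟩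
  exact StronglyMeasurable.integral_kernel_prod_right' (κ := Kq) (hf.comp measurable_snd).stronglyMeasurable

/-! ### The resolvent on nice observables -/

omit hN hT in
/-- **The resolvent integrand is integrable**: for `λ > 0` and nice `f`,
`t ↦ e^{-λt} P_t f(z)` is integrable on `(0, ∞)` (it is measurable and bounded by a constant multiple
of `e^{-λt}`). [folklore] -/
theorem pinnedChain_integrableOn_resolvent {ϑ K c : ℝ} (hϑ0 : 0 < ϑ)
    (hb : ∀ (z : PhaseSpace N) (t : ℝ≥0) (f : PhaseSpace N → ℝ), Continuous f →
      ∀ C : ℝ, 0 ≤ C → (∀ y, |f y| ≤ C * Real.exp (ϑ * (pinnedChain ω₂ lam β γ).hamiltonian N y)) →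
      |(∫ y, f y ∂((pinnedChain ω₂ lam β γ).transitionKernel N T T t z)) -
          ∫ y, f y ∂((pinnedChain ω₂ lam β γ).gibbsMeasure N T)| ≤
        K * C * Real.exp (ϑ * (pinnedChain ω₂ lam β γ).hamiltonian N z) * Real.exp (-c * t))
    (hc : 0 < c) {f : PhaseSpace N → ℝ} (hf : Continuous f) {C : ℝ} (hC : 0 ≤ C)
    (hfb : ∀ y, |f y| ≤ C * Real.exp (ϑ * (pinnedChain ω₂ lam β γ).hamiltonian N y))
    {lam' : ℝ} (hlam : 0 < lam') (z : PhaseSpace N) :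
    IntegrableOn (fun t : ℝ => Real.exp (-(lam' * t)) *
      ∫ y, f y ∂((pinnedChain ω₂ lam β γ).transitionKernel N T T t.toNNReal z)) (Ioi 0) := by
  set B := (|∫ y, f y ∂((pinnedChain ω₂ lam β γ).gibbsMeasure N T)| + K * C) *
    Real.exp (ϑ * (pinnedChain ω₂ lam β γ).hamiltonian N z) with hB
  have hmeas : AEStronglyMeasurable (fun t : ℝ => Real.exp (-(lam' * t)) *
      ∫ y, f y ∂((pinnedChain ω₂ lam β γ).transitionKernel N T T t.toNNReal z)) (volume.restrict (Ioi 0)) := by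
    have h1 := (pinnedChain_stronglyMeasurable_act_uncurry hω hl hβ.le hγ.le T T hf.measurable).comp_measurable
      (measurable_id.prodMk measurable_const : Measurable fun t : ℝ => (t, z))
    exact ((Real.continuous_exp.comp (continuous_const.mul continuous_id).neg).aestronglyMeasurable.mul
      h1.aestronglyMeasurable)
  refine Integrable.mono' ((exp_neg_integrableOn_Ioi 0 hlam).const_mul B) hmeas ?_
  refine (ae_restrict_iff' measurableSet_Ioi).2 (Eventually.of_forall fun t _ => ?_)
  rw [norm_mul, Real.norm_eq_abs, Real.norm_eq_abs, abs_of_pos (Real.exp_pos _), neg_mul, mul_comm B]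
  exact mul_le_mul_of_nonneg_left (pinnedChain_abs_act_le hω hl hβ hϑ0 hb hc hf hC hfb z _)
    (Real.exp_pos _).le

omit hω hl hβ hγ hN hT in
/-- `∫_{(0,∞)} e^{-λt} dt = 1/λ`. [folklore] -/
theorem integral_exp_neg_mul_Ioi {lam' : ℝ} (hlam : 0 < lam') :
    ∫ t in Ioi (0 : ℝ), Real.exp (-(lam' * t)) = 1 / lam' := by
  have h := integral_exp_mul_Ioi (a := -lam') (by linarith) 0
  simp only [mul_zero, Real.exp_zero, neg_mul] at h
  rw [h]
  field_simp

omit hγ hN hT in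
/-- **Bound on the resolvent**: `|R_λ f(z)| ≤ (|μ_T f| + K C) e^{ϑH(z)} / λ` for nice `f`, `λ > 0`.
[folklore] -/
theorem pinnedChain_abs_resolvent_le {ϑ K c : ℝ} (hϑ0 : 0 < ϑ)
    (hb : ∀ (z : PhaseSpace N) (t : ℝ≥0) (f : PhaseSpace N → ℝ), Continuous f →
      ∀ C : ℝ, 0 ≤ C → (∀ y, |f y| ≤ C * Real.exp (ϑ * (pinnedChain ω₂ lam β γ).hamiltonian N y)) →
      |(∫ y, f y ∂((pinnedChain ω₂ lam β γ).transitionKernel N T T t z)) -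
          ∫ y, f y ∂((pinnedChain ω₂ lam β γ).gibbsMeasure N T)| ≤
        K * C * Real.exp (ϑ * (pinnedChain ω₂ lam β γ).hamiltonian N z) * Real.exp (-c * t))
    (hc : 0 < c) {f : PhaseSpace N → ℝ} (hf : Continuous f) {C : ℝ} (hC : 0 ≤ C)
    (hfb : ∀ y, |f y| ≤ C * Real.exp (ϑ * (pinnedChain ω₂ lam β γ).hamiltonian N y))
    {lam' : ℝ} (hlam : 0 < lam') (z : PhaseSpace N) :
    |∫ t in Ioi (0 : ℝ), Real.exp (-(lam' * t)) *
        ∫ y, f y ∂((pinnedChain ω₂ lam β γ).transitionKernel N T T t.toNNReal z)| ≤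
      (|∫ y, f y ∂((pinnedChain ω₂ lam β γ).gibbsMeasure N T)| + K * C) *
        Real.exp (ϑ * (pinnedChain ω₂ lam β γ).hamiltonian N z) / lam' := by
  set B := (|∫ y, f y ∂((pinnedChain ω₂ lam β γ).gibbsMeasure N T)| + K * C) *
    Real.exp (ϑ * (pinnedChain ω₂ lam β γ).hamiltonian N z) with hB
  have hbound : ∀ᵐ t ∂(volume.restrict (Ioi (0 : ℝ))), ‖Real.exp (-(lam' * t)) *
      ∫ y, f y ∂((pinnedChain ω₂ lam β γ).transitionKernel N T T t.toNNReal z)‖ ≤ B * Real.exp (-(lam' * t)) := by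
    refine (ae_restrict_iff' measurableSet_Ioi).2 (Eventually.of_forall fun t _ => ?_)
    rw [norm_mul, Real.norm_eq_abs, Real.norm_eq_abs, abs_of_pos (Real.exp_pos _), mul_comm B]
    exact mul_le_mul_of_nonneg_left (pinnedChain_abs_act_le hω hl hβ hϑ0 hb hc hf hC hfb z _)
      (Real.exp_pos _).le
  have hI : Integrable (fun t : ℝ => B * Real.exp (-(lam' * t))) (volume.restrict (Ioi 0)) := by
    have := (exp_neg_integrableOn_Ioi 0 hlam).const_mul B
    refine this.congr (Eventually.of_forall fun t => ?_)
    simp [neg_mul]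
  have h := norm_integral_le_of_norm_le hI hbound
  rw [Real.norm_eq_abs, integral_const_mul, integral_exp_neg_mul_Ioi hlam] at h
  calc _ ≤ B * (1 / lam') := h
    _ = B / lam' := by ring

omit hβ hγ hN hT in
/-- `z ↦ R_λ f(z)` is (strongly) measurable for measurable `f`. [folklore] -/
theorem pinnedChain_stronglyMeasurable_resolvent (hβ' : 0 ≤ β) (hγ' : 0 ≤ γ) (T_L T_R : ℝ)
    {f : PhaseSpace N → ℝ} (hf : Measurable f) (lam' : ℝ) :
    StronglyMeasurable fun z : PhaseSpace N => ∫ t in Ioi (0 : ℝ), Real.exp (-(lam' * t)) *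
      ∫ y, f y ∂((pinnedChain ω₂ lam β γ).transitionKernel N T_L T_R t.toNNReal z) := by
  have h1 := pinnedChain_stronglyMeasurable_act_uncurry hω hl hβ' hγ' T_L T_R hf
  have h2 : StronglyMeasurable fun q : ℝ × PhaseSpace N => Real.exp (-(lam' * q.1)) *
      ∫ y, f y ∂((pinnedChain ω₂ lam β γ).transitionKernel N T_L T_R q.1.toNNReal q.2) :=
    ((Real.continuous_exp.comp (continuous_const.mul continuous_fst).neg).stronglyMeasurable).mul h1
  exact StronglyMeasurable.integral_prod_left' (μ := volume.restrict (Ioi (0 : ℝ))) h2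

/-! ### Dynkin's identity in resolvent form -/

omit hN hT in
/-- For a bounded `g`, `|P_t g(z)|` is bounded by the bound of `g` (Markov kernels). [folklore] -/
theorem pinnedChain_abs_act_le_of_bounded {g : PhaseSpace N → ℝ} {B : ℝ} (hB : ∀ y, ‖g y‖ ≤ B)
    (t : ℝ≥0) (z : PhaseSpace N) :
    ‖∫ y, g y ∂((pinnedChain ω₂ lam β γ).transitionKernel N T T t z)‖ ≤ B := by
  haveI := pinnedChain_isMarkovKernel_transitionKernel hω hl hβ.le hγ.le N T T t
  have := norm_integral_le_of_norm_le_const (μ := (pinnedChain ω₂ lam β γ).transitionKernel N T T t z)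
    (Eventually.of_forall hB)
  simpa [probReal_univ] using this

/-- **Dynkin's identity, resolvent form.** For a test function `F` and `λ > 0`:
`R_λ(L F)(z) = λ R_λ F(z) - F(z)`, i.e. `∫₀^∞ e^{-λt} P_t(LF)(z) dt = λ ∫₀^∞ e^{-λt} P_tF(z) dt - F(z)`.
Proof: by Dynkin (`pinnedChain_dynkin`) and the continuity of `t ↦ P_t(LF)(z)`, `φ(t) = P_tF(z)` is
`C¹` on `(0,∞)` with `φ' = P_t(LF)(z)`; integrate `(e^{-λt}φ)' = e^{-λt}φ' - λe^{-λt}φ` over `(0,∞)`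
(`integral_Ioi_of_hasDerivAt_of_tendsto`; `φ` is bounded, `φ(0) = F(z)`).
[cite: CuneoEckmannHairerReyBellet2018, §3 p. 7] -/
theorem pinnedChain_resolvent_generator {F : PhaseSpace N → ℝ} (hF : ContDiff ℝ ∞ F)
    (hFc : HasCompactSupport F) {lam' : ℝ} (hlam : 0 < lam') (z : PhaseSpace N) :
    ∫ t in Ioi (0 : ℝ), Real.exp (-(lam' * t)) *
        ∫ y, (pinnedChain ω₂ lam β γ).generator N T T F y ∂((pinnedChain ω₂ lam β γ).transitionKernel N T T t.toNNReal z) =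
      lam' * (∫ t in Ioi (0 : ℝ), Real.exp (-(lam' * t)) *
        ∫ y, F y ∂((pinnedChain ω₂ lam β γ).transitionKernel N T T t.toNNReal z)) - F z := by
  set P := pinnedChain ω₂ lam β γ with hP
  have hU1 : ContDiff ℝ 1 P.U := pinnedChain_contDiff_U ω₂ lam β γ
  have hV1 : ContDiff ℝ 1 P.V := pinnedChain_contDiff_V ω₂ lam β γ
  have hF2 : ContDiff ℝ 2 F := hF.of_le (by norm_cast)
  set LF := P.generator N T T F with hLF
  have hLc : Continuous LF := P.continuous_generator hU1 hV1 N T T hF2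
  have hLs : HasCompactSupport LF := P.hasCompactSupport_generator N T T hF2 hFc
  obtain ⟨BF, hBF⟩ := hF.continuous.bounded_above_of_compact_support hFc
  obtain ⟨BL, hBL⟩ := hLc.bounded_above_of_compact_support hLs
  -- `φ(t) = P_{t⁺}F(z)`, `ψ(t) = P_{t⁺}(LF)(z)`
  set φ : ℝ → ℝ := fun t => ∫ y, F y ∂(P.transitionKernel N T T t.toNNReal z) with hφ
  set ψ : ℝ → ℝ := fun t => ∫ y, LF y ∂(P.transitionKernel N T T t.toNNReal z) with hψ
  have hφc : Continuous φ := pinnedChain_continuous_integral_transitionKernel_time hω hl hβ hγ hF.continuous hBF z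
  have hψc : Continuous ψ := pinnedChain_continuous_integral_transitionKernel_time hω hl hβ hγ hLc hBL z
  have hφb : ∀ t, ‖φ t‖ ≤ BF := fun t => pinnedChain_abs_act_le_of_bounded hω hl hβ hγ hBF _ z
  have hψb : ∀ t, ‖ψ t‖ ≤ BL := fun t => pinnedChain_abs_act_le_of_bounded hω hl hβ hγ hBL _ z
  have hφ0 : φ 0 = F z := by
    simp only [hφ]
    rw [hP, Real.toNNReal_zero, pinnedChain_transitionKernel_zero hω hl hβ.le hγ.le N T T, Kernel.id_apply,
      integral_dirac]
  -- Dynkin: `φ t = F z + ∫₀ᵗ ψ` for `t ≥ 0`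
  have hdyn : ∀ t : ℝ, 0 ≤ t → φ t = F z + ∫ s in (0 : ℝ)..t, ψ s := by
    intro t ht
    have h := pinnedChain_dynkin hω hl hβ.le hγ.le hN hT.le hT.le F hF hFc t.toNNReal z
    rw [Real.coe_toNNReal t ht] at h
    simp only [hφ, hψ]
    linarith
  -- hence `φ' = ψ` on `(0, ∞)`
  have hderφ : ∀ t ∈ Ioi (0 : ℝ), HasDerivAt φ (ψ t) t := by
    intro t ht
    have h1 : HasDerivAt (fun u => F z + ∫ s in (0 : ℝ)..u, ψ s) (ψ t) t := by
      have := intervalIntegral.integral_hasDerivAt_right (hψc.intervalIntegrable 0 t)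
        (hψc.stronglyMeasurableAtFilter _ _) hψc.continuousAt
      exact this.const_add (F z)
    refine h1.congr_of_eventuallyEq ?_
    filter_upwards [Ioi_mem_nhds ht] with u hu
    exact hdyn u (le_of_lt hu)
  -- `G(t) = e^{-λt} φ(t)` and its derivative
  set G : ℝ → ℝ := fun t => Real.exp (-(lam' * t)) * φ t with hG
  set G' : ℝ → ℝ := fun t => Real.exp (-(lam' * t)) * ψ t - lam' * (Real.exp (-(lam' * t)) * φ t) with hG'
  have hexp : ∀ t, HasDerivAt (fun u => Real.exp (-(lam' * u))) (-lam' * Real.exp (-(lam' * t))) t := by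
    intro t
    have := ((hasDerivAt_id t).const_mul lam').neg.exp
    simpa [mul_comm] using this
  have hderG : ∀ t ∈ Ioi (0 : ℝ), HasDerivAt G (G' t) t := by
    intro t ht
    have := (hexp t).mul (hderφ t ht)
    refine this.congr_deriv ?_
    simp only [hG']
    ring
  have hGc : Continuous G := (Real.continuous_exp.comp (continuous_const.mul continuous_id).neg).mul hφc
  have hG'int : IntegrableOn G' (Ioi 0) := by
    have hm : AEStronglyMeasurable G' (volume.restrict (Ioi 0)) := by
      have : Continuous G' := ((Real.continuous_exp.comp (continuous_const.mul continuous_id).neg).mul hψc).sub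
        (continuous_const.mul ((Real.continuous_exp.comp (continuous_const.mul continuous_id).neg).mul hφc))
      exact this.aestronglyMeasurable
    refine Integrable.mono' ((exp_neg_integrableOn_Ioi 0 hlam).const_mul (BL + lam' * BF)) hm ?_
    refine (ae_restrict_iff' measurableSet_Ioi).2 (Eventually.of_forall fun t _ => ?_)
    have e0 : 0 < Real.exp (-(lam' * t)) := Real.exp_pos _
    have h1 : ‖Real.exp (-(lam' * t)) * ψ t‖ ≤ Real.exp (-(lam' * t)) * BL := by
      rw [norm_mul, Real.norm_eq_abs, abs_of_pos e0]
      exact mul_le_mul_of_nonneg_left (hψb t) e0.le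
    have h2 : ‖lam' * (Real.exp (-(lam' * t)) * φ t)‖ ≤ lam' * (Real.exp (-(lam' * t)) * BF) := by
      rw [norm_mul, norm_mul, Real.norm_eq_abs, Real.norm_eq_abs, abs_of_pos hlam, abs_of_pos e0]
      exact mul_le_mul_of_nonneg_left (mul_le_mul_of_nonneg_left (hφb t) e0.le) hlam.le
    calc ‖G' t‖ ≤ ‖Real.exp (-(lam' * t)) * ψ t‖ + ‖lam' * (Real.exp (-(lam' * t)) * φ t)‖ := norm_sub_le _ _
      _ ≤ Real.exp (-(lam' * t)) * BL + lam' * (Real.exp (-(lam' * t)) * BF) := add_le_add h1 h2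
      _ = (BL + lam' * BF) * Real.exp (-lam' * t) := by rw [neg_mul]; ring
  have hGlim : Tendsto G atTop (𝓝 0) := by
    have h0 : Tendsto (fun t : ℝ => Real.exp (-(lam' * t)) * BF) atTop (𝓝 0) := by
      have : Tendsto (fun t : ℝ => Real.exp (-(lam' * t))) atTop (𝓝 0) := by
        have := Real.tendsto_exp_atBot.comp (tendsto_id.const_mul_atTop_of_neg (neg_neg_iff_pos.2 hlam) :
          Tendsto (fun t : ℝ => -lam' * t) atTop atBot)
        refine this.congr fun t => ?_
        simp [neg_mul]
      simpa using this.mul_const BF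
    refine squeeze_zero_norm (fun t => ?_) h0
    rw [hG, norm_mul, Real.norm_eq_abs, abs_of_pos (Real.exp_pos _)]
    exact mul_le_mul_of_nonneg_left (hφb t) (Real.exp_pos _).le
  have hFTC := integral_Ioi_of_hasDerivAt_of_tendsto hGc.continuousWithinAt hderG hG'int hGlim
  rw [hG] at hFTC
  simp only [mul_zero, Real.exp_zero, one_mul, hφ0, zero_sub, neg_zero] at hFTC
  -- split `∫ G' = ∫ e^{-λt}ψ - λ ∫ e^{-λt}φ`
  obtain ⟨K, c, -, hc, hb⟩ := pinnedChain_harris_bound hω hl hβ hγ hN hT (ϑ := 1 / (2 * T)) (by positivity)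
    (by rw [div_lt_div_iff_of_pos_left one_pos (by positivity) hT]; linarith)
  have hϑ0 : (0 : ℝ) < 1 / (2 * T) := by positivity
  have hbdF : ∀ y, |F y| ≤ BF * Real.exp (1 / (2 * T) * P.hamiltonian N y) := fun y =>
    ((Real.norm_eq_abs _).symm.le.trans (hBF y)).trans
      (le_mul_of_one_le_right ((norm_nonneg _).trans (hBF y))
        (pinnedChain_one_le_exp_mul_hamiltonian hω hl hβ hϑ0.le y))
  have hbdL : ∀ y, |LF y| ≤ BL * Real.exp (1 / (2 * T) * P.hamiltonian N y) := fun y =>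
    ((Real.norm_eq_abs _).symm.le.trans (hBL y)).trans
      (le_mul_of_one_le_right ((norm_nonneg _).trans (hBL y))
        (pinnedChain_one_le_exp_mul_hamiltonian hω hl hβ hϑ0.le y))
  have hBF0 : 0 ≤ BF := (norm_nonneg _).trans (hBF z)
  have hBL0 : 0 ≤ BL := (norm_nonneg _).trans (hBL z)
  have iψ := pinnedChain_integrableOn_resolvent hω hl hβ hγ hϑ0 hb hc hLc hBL0 hbdL hlam z
  have iφ := pinnedChain_integrableOn_resolvent hω hl hβ hγ hϑ0 hb hc hF.continuous hBF0 hbdF hlam z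
  have hsplit : ∫ t in Ioi (0 : ℝ), G' t = (∫ t in Ioi (0 : ℝ), Real.exp (-(lam' * t)) * ψ t) -
      lam' * ∫ t in Ioi (0 : ℝ), Real.exp (-(lam' * t)) * φ t := by
    rw [hG', integral_sub iψ (iφ.const_mul lam'), integral_const_mul]
  rw [hsplit] at hFTC
  simp only [hψ, hφ] at hFTC
  linarith

end Pinned

end Summit.AtomisticToContinuum.FouriersLaw.Theorems.OddSectorIrreversibility

end
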